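import Literature.NumberTheory.Automorphic.UnboundedDenominatorsFullLevelFieldProofs
import Literature.NumberTheory.Automorphic.UnboundedDenominatorsDegreeLowerBoundProofs
import Mathlib.FieldTheory.Fixed
import Mathlib.Algebra.Ring.Action.End
import HarnessLib

/-!
# The unbounded denominators theorem (Calegari–Dimitrov–Tang) — `M_N` is the full level-`N` function field (`hrat`), and Theorem 1.0.1 from two printed inputs

PROOF-ONLY sequel (no definition, no named fact; D-0026) of
`UnboundedDenominatorsFullLevelFieldProofs.lean` (`K_N = ℂ(all level-Γ(N) functions)` ⊇ `M_N`,
`SL₂(ℤ)`-stable, `K_N^{Γ(2)} ⊆ M_2`, `hrat 2`) and `UnboundedDenominatorsDegreeLowerBoundProofs.lean`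
(`[Γ(2) : Γ(N)] ≤ 2 [M_N : M_2]`). Source: F. Calegari, V. Dimitrov, Y. Tang, *The unbounded
denominators conjecture*, J. Amer. Math. Soc. **38** (2025), §4.2 (Lemma 4.2.3, display (4.3.3):
`[M_N : M_2] = ½ [Γ(2) : Γ(N)]`) and §6.3.

The tree's rationality input `hrat N` — "every `F/Δᵐ` with `F ∈ M_{12m}(Γ(N))` lies in
`M_N = levelField N` (the field generated by the INTEGRAL-expansion generators)", Shimura's
Theorem 3.52 in hypothesis form — is PROVED here for even `N` by Galois theory alone:

* ★ `adjoin_lvl_eq_levelField` — **`K_N = M_N`** for `N = 2d ≥ 4`: the finite group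
  `Γ(2)/(± Γ(N))` acts on `K_N` with fixed field inside `M_2`, so Artin's lemma
  (Mathlib `FixedPoints.finrank_le_card`) gives `[K_N : M_2] ≤ ½[Γ(2):Γ(N)]`, while
  `[M_N : M_2] ≥ ½[Γ(2):Γ(N)]` (`card_quotient_le_two_mul_relfinrank`); as `M_N ≤ K_N`, equality;
* ★★ `hrat_of_even` — `hrat N` for every even `N > 0`;
* ★★★ `CalegariDimitrovTang2025_unboundedDenominators.of_two_inputs` — **CDT Theorem 1.0.1 from
  TWO printed inputs**: the amalgam/congruence-subgroup-property sentence `hker₂` (Serre, Mennicke;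
  CDT Lemma 4.6.2) and CDT Corollary 4.5.3 `hcor`. Proposition 3.0.1, (4.3.3) and the rationality
  of `M_N` are theorems of the tree.

## References

* [CalegariDimitrovTang2025] F. Calegari, V. Dimitrov, Y. Tang, The unbounded denominators
  conjecture, J. Amer. Math. Soc. 38 (2025), no. 3, 627–702; arXiv:2109.09040. §4.2, §6.3.
-/

noncomputable section

namespace Literature.NumberTheory.Automorphic

open scoped MatrixGroups ModularForm
open UpperHalfPlane CongruenceSubgroup Matrix.SpecialLinearGroup ModularGroup

namespace UnboundedDenominators

/-! ### §1. `K_N = M_N` by Artin's lemma -/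

/-- `Γ(N') ≤ Γ(N)` for `N ∣ N'`. [folklore] -/
private theorem Gamma_le_Gamma_of_dvd'' {N N' : ℕ} (h : N ∣ N') : Gamma N' ≤ Gamma N := by
  intro A hA
  rw [Gamma_mem] at hA ⊢
  obtain ⟨h00, h01, h10, h11⟩ := hA
  have c00 := congrArg (ZMod.castHom h (ZMod N)) h00
  have c01 := congrArg (ZMod.castHom h (ZMod N)) h01
  have c10 := congrArg (ZMod.castHom h (ZMod N)) h10
  have c11 := congrArg (ZMod.castHom h (ZMod N)) h11
  rw [map_intCast, map_one] at c00 c11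
  rw [map_intCast, map_zero] at c01 c10
  exact ⟨c00, c01, c10, c11⟩

/-- `-1 ∉ Γ(N)` for `N ≥ 3`. [folklore] -/
private theorem neg_one_not_mem_Gamma {N : ℕ} (hN : 3 ≤ N) : (-1 : SL(2, ℤ)) ∉ Gamma N := by
  intro h
  obtain ⟨h00, -, -, -⟩ := Gamma_mem.mp h
  simp only [Matrix.SpecialLinearGroup.coe_neg, Matrix.SpecialLinearGroup.coe_one, Matrix.neg_apply,
    Matrix.one_apply_eq, Int.cast_neg, Int.cast_one] at h00
  haveI : Fact (2 < N) := ⟨by omega⟩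
  have h2 : (2 : ZMod N) = 0 := by linear_combination -h00
  have := (ZMod.natCast_eq_zero_iff 2 N).mp (by exact_mod_cast h2)
  exact absurd (Nat.le_of_dvd two_pos this) (by omega)

/-- **Artin's lemma for the action of `Γ(2)` on an `SL(2, ℤ)`-stable subfield `K ⊆ Mer` fixed
pointwise by `Γ(N)`** (`N ≥ 3`): the subfield of `Γ(2)`-invariants of `K` has finite index, at most
`½ [Γ(2) : Γ(N)]` — the finite group `Γ(2)/Γ(N)` acts on `K` through a quotient `G` in which the
class of `-1` (which acts trivially on `Mer`) is killed, so `#G ≤ ½[Γ(2):Γ(N)]`, and Mathlib's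
`FixedPoints.finrank_le_card` applies. [cite: CalegariDimitrovTang2025, §4.2 (4.3.3)] -/
theorem exists_fixed_subfield_finrank_le (K : IntermediateField ℂ Mer) {N : ℕ} (hN3 : 3 ≤ N)
    (hstab : ∀ (γ : SL(2, ℤ)) (x : Mer), x ∈ K → γ • x ∈ K)
    (hKinv : K ≤ invariantField (Gamma N)) :
    ∃ S : Subfield K, (∀ x : K, x ∈ S ↔ ∀ γ ∈ Gamma 2, γ • (x : Mer) = x) ∧
      FiniteDimensional S K ∧
      2 * Module.finrank S K ≤ Nat.card (Gamma 2 ⧸ (Gamma N).subgroupOf (Gamma 2)) := by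
  classical
  haveI : NeZero N := ⟨by omega⟩
  -- (1) the action of `SL(2, ℤ)` on the field `K` by ring automorphisms
  let toAut : SL(2, ℤ) → (K ≃+* K) := fun γ ↦
    { toFun := fun x ↦ ⟨γ • (x : Mer), hstab γ x x.2⟩
      invFun := fun x ↦ ⟨γ⁻¹ • (x : Mer), hstab γ⁻¹ x x.2⟩
      left_inv := fun x ↦ Subtype.ext (inv_smul_smul γ (x : Mer))
      right_inv := fun x ↦ Subtype.ext (smul_inv_smul γ (x : Mer))
      map_mul' := fun x y ↦ Subtype.ext (smul_mul' γ (x : Mer) y)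
      map_add' := fun x y ↦ Subtype.ext (smul_add γ (x : Mer) y) }
  let ρ : SL(2, ℤ) →* (K ≃+* K) :=
    { toFun := toAut
      map_one' := by
        apply RingEquiv.ext
        intro x
        exact Subtype.ext (one_smul _ (x : Mer))
      map_mul' := fun γ δ ↦ by
        apply RingEquiv.ext
        intro x
        exact Subtype.ext (mul_smul γ δ (x : Mer)) }
  -- restrict to `Γ(2)` and descend to `Q = Γ(2)/Γ(N)` (`Γ(N)` acts trivially on `K`)
  let H : Subgroup (Gamma 2) := (Gamma N).subgroupOf (Gamma 2)
  haveI hHn : H.Normal := (Gamma_normal N).subgroupOf (Gamma 2)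
  let ρ₂ : (Gamma 2) →* (K ≃+* K) := ρ.comp (Gamma 2).subtype
  have hker : H ≤ ρ₂.ker := by
    intro g hg
    rw [MonoidHom.mem_ker]
    apply RingEquiv.ext
    intro x
    apply Subtype.ext
    change ((g : SL(2, ℤ)) • (x : Mer)) = x
    exact mem_invariantField_iff.mp (hKinv x.2) _ (Subgroup.mem_subgroupOf.mp hg)
  let ρQ : (Gamma 2 ⧸ H) →* (K ≃+* K) := QuotientGroup.lift H ρ₂ hker
  have ρQ_mk : ∀ (g : Gamma 2) (x : K),
      ((ρQ (QuotientGroup.mk g) x : K) : Mer) = (g : SL(2, ℤ)) • (x : Mer) := by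
    intro g x
    change (((QuotientGroup.lift H ρ₂ hker) (QuotientGroup.mk g)) x : Mer) = _
    rw [QuotientGroup.lift_mk]
    rfl
  -- (2) the faithful quotient `G = Q/ker ρQ` and its cardinality `≤ ½ #Q`
  haveI : Fintype (Gamma 2 ⧸ H) := Fintype.ofFinite _
  let G := (Gamma 2 ⧸ H) ⧸ ρQ.ker
  haveI : Fintype G := Fintype.ofFinite _
  let ρG : G →* (K ≃+* K) := QuotientGroup.kerLift ρQ
  letI : MulSemiringAction G K := MulSemiringAction.compHom K ρG
  have smul_def : ∀ (g : G) (x : K), g • x = ρG g x := fun _ _ ↦ rfl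
  -- `-1` gives a non-trivial element of `ker ρQ`
  have hneg1 : (-1 : SL(2, ℤ)) ∈ Gamma 2 := by
    rw [Gamma_mem]
    simp only [Matrix.SpecialLinearGroup.coe_neg, Matrix.SpecialLinearGroup.coe_one,
      Matrix.neg_apply, Matrix.one_apply_eq, ne_eq, zero_ne_one, not_false_eq_true,
      Matrix.one_apply_ne, one_ne_zero, neg_zero, Int.cast_zero, Int.cast_neg, Int.cast_one,
      and_self, true_and]
    decide
  let ε : Gamma 2 ⧸ H := QuotientGroup.mk ⟨-1, hneg1⟩
  have hε_ker : ε ∈ ρQ.ker := by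
    rw [MonoidHom.mem_ker]
    apply RingEquiv.ext
    intro x
    apply Subtype.ext
    rw [ρQ_mk]
    exact neg_one_smul_mer (x : Mer)
  have hε_ne : ε ≠ 1 := by
    intro h
    have h' : ((⟨-1, hneg1⟩ : Gamma 2)) ∈ H := by
      rw [← QuotientGroup.eq_one_iff]; exact h
    exact neg_one_not_mem_Gamma hN3 (Subgroup.mem_subgroupOf.mp h')
  have hker2 : 2 ≤ Nat.card ρQ.ker := by
    have h1 : (1 : Gamma 2 ⧸ H) ∈ ρQ.ker := one_mem _
    haveI : Fintype ρQ.ker := Fintype.ofFinite _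
    rw [Nat.card_eq_fintype_card]
    exact Fintype.one_lt_card_iff_nontrivial.mpr ⟨⟨⟨ε, hε_ker⟩, ⟨1, h1⟩,
      fun h ↦ hε_ne (congrArg Subtype.val h)⟩⟩
  have hcardG : 2 * Nat.card G ≤ Nat.card (Gamma 2 ⧸ H) := by
    rw [Subgroup.card_eq_card_quotient_mul_card_subgroup ρQ.ker, mul_comm]
    exact Nat.mul_le_mul_left _ hker2
  -- (3) Artin: `[K : K^G] ≤ #G`, and the fixed field
  have hartin := FixedPoints.finrank_le_card G K
  refine ⟨FixedPoints.subfield G K, fun x ↦ ?_, inferInstance, ?_⟩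
  · change x ∈ MulAction.fixedPoints G K ↔ _
    rw [MulAction.mem_fixedPoints]
    constructor
    · intro h γ hγ
      have := congrArg (fun y : K ↦ (y : Mer)) (h (QuotientGroup.mk (QuotientGroup.mk ⟨γ, hγ⟩)))
      simp only [smul_def] at this
      rwa [QuotientGroup.kerLift_mk, ρQ_mk] at this
    · intro h g
      induction g using QuotientGroup.induction_on with
      | H q =>
        induction q using QuotientGroup.induction_on with
        | H γ =>
          apply Subtype.ext
          rw [smul_def, QuotientGroup.kerLift_mk, ρQ_mk]
          exact h γ γ.2
  · calc 2 * Module.finrank (FixedPoints.subfield G K) K ≤ 2 * Fintype.card G :=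
          Nat.mul_le_mul_left _ hartin
      _ = 2 * Nat.card G := by rw [Nat.card_eq_fintype_card]
      _ ≤ Nat.card (Gamma 2 ⧸ H) := hcardG

/-- **Degree transport**: for intermediate fields `L ≤ K` of `Mer/ℂ` and the copy `S` of `L` inside
`K` (a subfield of the field `K`), `finrank S K = [K : L]`. [folklore] -/
private theorem finrank_subfield_eq_relfinrank (K L : IntermediateField ℂ Mer) (hLK : L ≤ K)
    (S : Subfield K) (hS : ∀ x : K, x ∈ S ↔ (x : Mer) ∈ L) :
    Module.finrank S K = IntermediateField.relfinrank L K := by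
  let i₀ : S →+* L := (algebraMap K Mer).restrict S L fun x hx ↦ (hS x).mp hx
  have hi₀ : ∀ x : S, ((i₀ x : L) : Mer) = ((x : K) : Mer) := fun _ ↦ rfl
  have hi₀_inj : Function.Injective i₀ := by
    intro x y h
    have h' := congrArg (fun z : L ↦ (z : Mer)) h
    rw [hi₀, hi₀] at h'
    exact Subtype.ext (Subtype.ext h')
  have hi₀_surj : Function.Surjective i₀ := by
    intro y
    refine ⟨⟨⟨(y : Mer), hLK y.2⟩, (hS _).mpr y.2⟩, ?_⟩
    apply Subtype.ext
    rw [hi₀]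
  let i : S ≃+* L := RingEquiv.ofBijective i₀ ⟨hi₀_inj, hi₀_surj⟩
  let j : K ≃+* IntermediateField.extendScalars hLK :=
    { toFun := fun x ↦ ⟨(x : Mer), x.2⟩
      invFun := fun x ↦ ⟨(x : Mer), x.2⟩
      left_inv := fun _ ↦ rfl
      right_inv := fun _ ↦ rfl
      map_mul' := fun _ _ ↦ rfl
      map_add' := fun _ _ ↦ rfl }
  rw [IntermediateField.relfinrank_eq_finrank_of_le hLK]
  exact Algebra.finrank_eq_of_equiv_equiv i j (RingHom.ext fun _ ↦ rfl)

/-- ★ **`K_N = M_N` for `N = 2d ≥ 4`: the field generated by ALL level-`Γ(N)` functions equals the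
field generated by those with integral `q_N`-expansion** — the tree's form of "`M_N` may be
identified with the field of rational functions on `X(N)`", i.e. of Shimura's rationality of
`M_k(Γ(N))` as far as CDT need it. Proof: Artin's lemma for the finite group `Γ(2)/(±Γ(N))` acting
on `K_N` (fixed field `⊆ M_2`, `exists_fixed_subfield_finrank_le`) against the lower bound
`[M_N : M_2] ≥ ½[Γ(2):Γ(N)]` (`card_quotient_le_two_mul_relfinrank`).
[cite: CalegariDimitrovTang2025, Lemma 4.2.3 and (4.3.3)] -/
theorem adjoin_lvl_eq_levelField {d : ℕ} (hd : 2 ≤ d) :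
    IntermediateField.adjoin ℂ {y : Mer | ∃ (m : ℕ)
      (F : ModularForm ((Gamma (2 * d) : Subgroup SL(2, ℤ)) : Subgroup (GL (Fin 2) ℝ)) (12 * (m : ℤ))),
      y = algebraMap hol Mer (modFun m F)} = levelField (2 * d) := by
  classical
  set N := 2 * d with hNdef
  have hN3 : 3 ≤ N := by omega
  haveI : NeZero N := ⟨by omega⟩
  -- make `K = K_N` opaque (its definition is only used through the facts below)
  obtain ⟨K, hKdef⟩ : ∃ K : IntermediateField ℂ Mer, K = IntermediateField.adjoin ℂ {y : Mer | ∃ (m : ℕ)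
      (F : ModularForm ((Gamma N : Subgroup SL(2, ℤ)) : Subgroup (GL (Fin 2) ℝ)) (12 * (m : ℤ))),
      y = algebraMap hol Mer (modFun m F)} := ⟨_, rfl⟩
  rw [← hKdef]
  have hMK : levelField N ≤ K := hKdef ▸ levelField_le_adjoin_lvl N
  have h2M : levelField 2 ≤ levelField N := levelField_mono two_pos ⟨d, by omega⟩ (by omega)
  have h2K : levelField 2 ≤ K := h2M.trans hMK
  have hstab : ∀ (γ : SL(2, ℤ)) (x : Mer), x ∈ K → γ • x ∈ K := fun γ x hx ↦ by
    rw [hKdef] at hx ⊢; exact smul_mem_adjoin_lvl γ hx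
  have hKinv : K ≤ invariantField (Gamma N) := hKdef ▸ adjoin_lvl_le_invariantField N
  have hKfix : K ⊓ invariantField (Gamma 2) ≤ levelField 2 :=
    hKdef ▸ adjoin_lvl_inf_invariantField_Gamma_two_le (N := N) (by omega)
  -- Artin
  obtain ⟨S, hmemS, hSfin, hSle⟩ := exists_fixed_subfield_finrank_le K hN3 hstab hKinv
  -- the fixed field is the copy of `M_2`
  have hmemS' : ∀ x : K, x ∈ S ↔ (x : Mer) ∈ levelField 2 := by
    intro x
    rw [hmemS]
    constructor
    · intro h
      exact hKfix (IntermediateField.mem_inf.mpr ⟨x.2, mem_invariantField_iff.mpr h⟩)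
    · intro h γ hγ
      exact mem_invariantField_iff.mp (levelField_le_invariantField 2 h) γ hγ
  have hfinS : Module.finrank S K = IntermediateField.relfinrank (levelField 2) K :=
    finrank_subfield_eq_relfinrank K (levelField 2) h2K S hmemS'
  -- the squeeze
  have hlow := card_quotient_le_two_mul_relfinrank hd
  rw [← hNdef] at hlow
  have hle : IntermediateField.relfinrank (levelField 2) K ≤
      IntermediateField.relfinrank (levelField 2) (levelField N) := by
    rw [← hfinS]; omega
  have hposS : 0 < Module.finrank S K := Module.finrank_pos
  haveI : FiniteDimensional (levelField 2) (IntermediateField.extendScalars h2K) := by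
    apply FiniteDimensional.of_finrank_pos
    rw [← IntermediateField.relfinrank_eq_finrank_of_le h2K, ← hfinS]
    exact hposS
  have hE₁₂ : IntermediateField.extendScalars h2M ≤ IntermediateField.extendScalars h2K :=
    (IntermediateField.extendScalars_le_extendScalars_iff h2M h2K).mpr hMK
  have heq : IntermediateField.extendScalars h2M = IntermediateField.extendScalars h2K := by
    apply IntermediateField.eq_of_le_of_finrank_le hE₁₂
    rw [← IntermediateField.relfinrank_eq_finrank_of_le h2K,
      ← IntermediateField.relfinrank_eq_finrank_of_le h2M]
    exact hle
  have hKM : K ≤ levelField N :=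
    (IntermediateField.extendScalars_le_extendScalars_iff h2K h2M).mp (le_of_eq heq.symm)
  exact le_antisymm hKM hMK

/-! ### §2. `hrat` for even levels -/

/-- ★★ **The rationality input `hrat` holds at every even level**: for `N > 0` even, every `F/Δᵐ`
with `F ∈ M_{12m}(Γ(N))` lies in `M_N = levelField N` (the field generated by the forms with integral
`q_N`-expansion) — Shimura 1971, Thm 3.52 as far as CDT use it, obtained here from Artin's lemma
and the degree count (4.3.3). [cite: CalegariDimitrovTang2025, Lemma 4.2.3] -/
theorem hrat_of_even {N : ℕ} (hN : 0 < N) (heven : Even N) (m : ℕ)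
    (F : ModularForm ((Gamma N : Subgroup SL(2, ℤ)) : Subgroup (GL (Fin 2) ℝ)) (12 * (m : ℤ))) :
    algebraMap hol Mer (modFun m F) ∈ levelField N := by
  obtain ⟨d, hd⟩ := heven
  have hNd : N = 2 * d := by omega
  subst hNd
  rcases Nat.lt_or_ge d 2 with hd2 | hd2
  · have hd1 : d = 1 := by omega
    subst hd1
    exact algebraMap_modFun_mem_levelField_two le_rfl F
  · rw [← adjoin_lvl_eq_levelField hd2]
    exact IntermediateField.subset_adjoin ℂ _ ⟨m, F, rfl⟩

/-! ### §3. Theorem 1.0.1 from two printed inputs -/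

/-- ★★★ **CDT Theorem 1.0.1 from TWO printed inputs** [cite: CalegariDimitrovTang2025, §6.3]: the
named fact `CalegariDimitrovTang2025_unboundedDenominators` follows from `hker₂` (the amalgam
`Γ(N) ⋆ A⁻¹Γ(N)A ≅ Γ̃(N) ≤ SL₂(ℤ[1/p])` + congruence subgroup property — Ihara's lemma in Ribet's
form, CDT Lemma 4.6.2) and `hcor` (CDT Corollary 4.5.3). Everything else — Proposition 3.0.1
(`linearIndepOn_bddDenGens_card_le`), (4.3.3) (`relfinrank_levelField_ge`), the rationality of
`M_N` (`hrat_of_even`), §§4.1–4.3 and the §6.3 leveraging — is proved in the tree. -/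
theorem _root_.Literature.NumberTheory.Automorphic.CalegariDimitrovTang2025_unboundedDenominators.of_two_inputs
    (hker₂ : ∀ (N p : ℕ) (A : GL (Fin 2) ℝ), 0 < N →
      (A : Matrix (Fin 2) (Fin 2) ℝ) = !![(p : ℝ), 0; 0, 1] → p.Prime → ¬ p ∣ N →
      ∀ (Δ : Type) [Group Δ] [Finite Δ] (g₁ g₂ : Gamma N →* Δ),
      (∀ (x : SL(2, ℤ)) (hx : x ∈ Gamma N), x ∈ Gamma0 p → ∀ (y : SL(2, ℤ)) (hy : y ∈ Gamma N),
        A * mapGL ℝ x = mapGL ℝ y * A → g₁ ⟨x, hx⟩ = g₂ ⟨y, hy⟩) →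
      (∃ M : ℕ, M ≠ 0 ∧ ∀ (x : SL(2, ℤ)) (hx : x ∈ Gamma N), x ∈ Gamma M → g₁ ⟨x, hx⟩ = 1) ∧
      (∃ M : ℕ, M ≠ 0 ∧ ∀ (x : SL(2, ℤ)) (hx : x ∈ Gamma N), x ∈ Gamma M → g₂ ⟨x, hx⟩ = 1))
    (hcor : ∀ (N : ℕ) (Q : Type) [CommGroup Q] [Finite Q] (θ : Gamma N →* Q),
      (∀ g : SL(2, ℤ), ∃ M : ℕ, M ≠ 0 ∧ ∀ (x : SL(2, ℤ)) (hx : x ∈ Gamma N)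
        (hgx : g * x * g⁻¹ ∈ Gamma N), x ∈ Gamma M → θ ⟨g * x * g⁻¹, hgx⟩ = θ ⟨x, hx⟩) →
      ∃ M : ℕ, M ≠ 0 ∧ ∀ (x : SL(2, ℤ)) (hx : x ∈ Gamma N), x ∈ Gamma M → θ ⟨x, hx⟩ = 1) :
    CalegariDimitrovTang2025_unboundedDenominators := by
  -- Proposition 3.0.1 and (4.3.3) from the tree
  obtain ⟨C₀, hC₀⟩ := linearIndepOn_bddDenGens_card_le
  have hfin : ∀ N : ℕ, 0 < N → Even N →
      0 < IntermediateField.relfinrank (levelField 2) (bddDenField N) := fun N hN heven ↦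
    (relfinrank_pos_and_le_of_linearIndepOn_real_bound hN heven (hC₀ N hN heven)).1
  have hhol : ∀ N : ℕ, 0 < N → Even N →
      (IntermediateField.relfinrank (levelField 2) (bddDenField N) : ℝ) ≤
        C₀ * (N : ℝ) ^ 3 * Real.log N := fun N hN heven ↦
    (relfinrank_pos_and_le_of_linearIndepOn_real_bound hN heven (hC₀ N hN heven)).2
  obtain ⟨c, hc, hdeg⟩ := relfinrank_levelField_ge
  refine CalegariDimitrovTang2025_unboundedDenominators.of_bddDenField_le_levelField
    fun N hN heven ↦ ?_
  -- leveraging on the even positive integers, as in `…of_printed_inputs'`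
  let S : Set ℕ := {N | 0 < N ∧ Even N}
  have hS : ∀ N ∈ S, ∀ p : ℕ, p.Prime → ¬ p ∣ N → N * p ∈ S := fun N hNS p hp _ ↦
    ⟨Nat.mul_pos hNS.1 hp.pos, hNS.2.mul_right p⟩
  let r : ℕ → ℕ := fun N ↦ IntermediateField.relfinrank (levelField N) (bddDenField N)
  have hdouble : ∀ N ∈ S, ∀ p : ℕ, p.Prime → ¬ p ∣ N → 1 < r N → 2 * r N ≤ r (N * p) := by
    intro N hNS p hp hpN h1
    obtain ⟨A, hA⟩ : ∃ A : GL (Fin 2) ℝ, (A : Matrix (Fin 2) (Fin 2) ℝ) = !![(p : ℝ), 0; 0, 1] :=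
      ⟨Matrix.GeneralLinearGroup.mkOfDetNeZero !![(p : ℝ), 0; 0, 1]
        (by rw [Matrix.det_fin_two_of]; simp [hp.ne_zero]), rfl⟩
    have hNp : N.Coprime p := ((Nat.Prime.coprime_iff_not_dvd hp).mpr hpN).symm
    have hNpS : N * p ∈ S := hS N hNS p hp hpN
    have hne : bddDenField N ≠ levelField N := by
      intro heq
      have : r N = 1 := by
        change IntermediateField.relfinrank (levelField N) (bddDenField N) = 1
        rw [heq, IntermediateField.relfinrank_self]
      omega
    exact two_mul_relfinrank_le hNS.1.ne' hp hNp hA (hker₂ N p A hNS.1 hA hp hpN) (hcor N)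
      (hrat_of_even hNS.1 hNS.2) (hrat_of_even hNpS.1 hNpS.2)
      (fg_bddDenField_of_relfinrank_pos hNS.1 hNS.2 (hfin N hNS.1 hNS.2))
      (relfinrank_levelField_pos_of_two hNS.1 hNS.2 (dvd_mul_right N p)
        (hfin (N * p) hNpS.1 hNpS.2)) hne
  have hle : r N ≤ 1 :=
    CalegariDimitrovTang2025_unboundedDenominators.le_one_of_log_bound_of_doubling hS r (C₀ / c)
      (fun N hNS ↦ log_gap_of_degree_bounds hc hdeg hhol N hNS.1 hNS.2) hdouble N ⟨hN, heven⟩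
      hN.ne'
  have hpos : 0 < r N := relfinrank_levelField_pos_of_two hN heven dvd_rfl (hfin N hN heven)
  have h1 : IntermediateField.relfinrank (levelField N) (bddDenField N) = 1 := by
    change r N = 1
    omega
  exact IntermediateField.relfinrank_eq_one_iff.mp h1

end UnboundedDenominators

end Literature.NumberTheory.Automorphic

end
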